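import Summits.QuantumFields.YangMills.Theorems.BalabanUVNodesN21AtSRec12Weight
import Summits.QuantumFields.YangMills.Theorems.BalabanUVNodesN21LevelLedgerMixture

/-!
# YM-DAG node N21 (= NE7c) — THE N21 SLOT OF K3′'s COMPOSITE AT THE STAGE-12 HOMES ON THE MIXTURE ROAD: supplied by SHARP PUSHES uniform in the threshold
# (module 12a, ROW A′) through module 9's ∃-weight currency — NO (M1) binder, NO weight slot to match, N16's width rate a displayed letter `ρ_j ≤ c₁ϑ^j`

Track A of `YM-PLAN.md` (cell `pub-ymgap`, HUMAN RULING D-0062), node **N21**; R134 fan-out seat `pub-ymgap-dag-n21-d` (s2 = BY-NAME KNIT at the record), generation 3,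
module 13.  THEOREMS ONLY: 0 `def`, 0 `sorry`, standard axioms; COUNT-NEUTRAL; `--supports` the K3′ item `SpineGivenEndpointR12` (rev 15, stmt-QuantumFields-19908) as a
helper.  `N`-generic, NO Theses import (restate-immune).  Imports module 9 `BalabanUVNodesN21AtSRec12Weight` (p469219: `spine_rec12C_of_homes₁₂_existsShellWeight` over
dag-n27-c XXVII) and module 12a `BalabanUVNodesN21LevelLedgerMixture` (p472273: `n21_knit_thresholdMixture`).  Restates nothing; cites by name.

WHAT IS PROVED ([bookkeeping]; each ONE application BY NAME).
* §1 `shellWeightBound_geometric_keyed₁₂_of_sharpPushMixture` — for a spine reading `cr` whose carriers at every admissible Stage-12 tuple with provisos carry the SHARP-PUSH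
  MIXTURE DATA of module 12a (both runs: (R); per slot a finite field law with measurable tested variable, `θ_j > 0`, `κ_min ≤ κ_j < 1`, `ρ_j ≥ 0`, `M ≥ 0`, integrable
  sharp piece ∕ weight families with the two pushes at EVERY threshold of the window, pieces AND weights pinned as normalised window averages; live windows `(N₁, ν̄)`;
  the width rate `0 < ϑ < 1`, `ρ_j ≤ c₁ϑ^j`) — WITHOUT any clause on the weight slot `(cr …).Wsh` —: at every such tuple `∃ ϑ C, 0 < ϑ < 1 ∧ 0 ≤ C ∧ ShellWeightBound (cr …) … (K ↦ C·ϑ^K)` (`n21_knit_thresholdMixture` at its own geometric majorant) — in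
  particular module 9's ∃-weight certificate `hW`.
* §2 `spine_rec12C_of_homes₁₂_sharpPushMixture` — dag-n27-c XXVII's composite at the homes (six K4 stubs at `RRec₁₂ 𝔯`, `S_N27x`, `S_N20` at `SRec₁₂ cr`, the home-keyed
  N19′ edge) with THE N21 SLOT SUPPLIED BY §1 through module 9's `spine_rec12C_of_homes₁₂_existsShellWeight`: on the mixture road N21 contributes to K3′'s hypothesis
  list ONLY the sharp-push mixture data `hmix` — no (M1), no [dict], no END letters, no weight slot.  Conclusion `Spine ₁₂C`.

HONEST FRAMING (binding).  The sharp pushes (NODE O's term object at the Stage-12 record read uniformly over the admissible threshold window — located inputs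
(O-mix-1′∕2∕3′) of the lens memo), (R), admissible widths, live windows (N20) and the width rate (N16's content as a displayed letter, NOT derived from `S_N16` here) are
HYPOTHESES; every K4 ∕ K5 stub and the edge are HYPOTHESES (0∕1 today); `cr`, `𝔯` PARAMETERS; the mixture road is a convex combination of print's sharp procedure over
admissible thresholds, NOT print's construction verbatim; (M1) for the deterministic sharp procedure UNTOUCHED; nothing of Bałaban's asserted; NE7 ∕ NE7b ∕ NE7c NOT PRINTED for
d = 4 and NOT PROVED; **N21 NOT discharged**, N27 NOT discharged, K3′ NOT claimed; typed 28∕28, discharged count untouched; one finite four-torus programme at fixed `ε` —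
NOT ℝ⁴, NOT infinite volume, NOT OS, NOT a mass gap, NOT Clay.  No decl below carries a cite tag.
-/

set_option autoImplicit false

noncomputable section

open scoped BigOperators ENNReal
open MeasureTheory Set

namespace Summit.QuantumFields.YangMills.Theorems.N21AtSRec12Mixture

open Literature.MathematicalPhysics.QuantumFieldTheory.Balaban1983to89
open Literature.MathematicalPhysics.QuantumFieldTheory.Balaban1983to89.T4Continuum (T4Family ULoop)
open T4IndicatorShell (ShellWeightBound)
open T4ShellMeasureLevels (LevelLedger LiveWindow)
open Summit.QuantumFields.BalabanUV.T4Continuum.Spine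
open YMDAG.UVSplit
open Node00 (Stage12Params datumOfRecord₁₂ IsRecordOfRecord₁₂C IsDatumOfRecord₁₂C)
open N21AtSRec12Weight (spine_rec12C_of_homes₁₂_existsShellWeight)
open N21LevelLedgerMixture (n21_knit_thresholdMixture)

variable {N : ℕ} [NeZero N] (cr : SpineReading₁₂ N)
  (hmix : ∀ (F : T4Family) (θ : Stage12Params F N) (hP : θ.Provisos₁₂ F N), θ.Admissible F N → ∀ (g₀ : ℕ → ℝ) (os : List (ULoop F)),
        ∃ (σA σB : Type) (XA : ℕ → σA → Type) (XB : ℕ → σB → Type)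
          (_mA : ∀ K s, MeasurableSpace (XA K s)) (_mB : ∀ K s, MeasurableSpace (XB K s))
          (νA : ∀ K : ℕ, ℝ → ∀ s : σA, Measure (XA K s)) (νB : ∀ K : ℕ, ℝ → ∀ s : σB, Measure (XB K s))
          (_fA : ∀ K t s, IsFiniteMeasure (νA K t s)) (_fB : ∀ K t s, IsFiniteMeasure (νB K t s))
          (wA : ∀ K : ℕ, ℝ → ∀ s : σA, XA K s → ℝ) (wB : ∀ K : ℕ, ℝ → ∀ s : σB, XB K s → ℝ)
          (SA : ℕ → Finset σA) (SB : ℕ → Finset σB)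
          (pieceA : ℕ → ℝ → σA → (cr F θ hP g₀ os).ι → ℝ) (pieceB : ℕ → ℝ → σB → (cr F θ hP g₀ os).ι → ℝ)
          (lvlA : ℕ → σA → ℕ) (lvlB : ℕ → σB → ℕ) (θA κA ρA θB κB ρB : ℕ → ℝ)
          (MA : ℕ → ℝ → σA → ℝ) (MB : ℕ → ℝ → σB → ℝ)
          (pcA AsA : ∀ K : ℕ, ℝ → ∀ s : σA, ℝ → (cr F θ hP g₀ os).ι → ℝ) (pcB AsB : ∀ K : ℕ, ℝ → ∀ s : σB, ℝ → (cr F θ hP g₀ os).ι → ℝ)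
          (N₁ : ℕ) (νbar κmin c₁ ϑ : ℝ),
          -- run A: (R), measurability, signs, integrability, SHARP pushes at every threshold of the window, carriers pinned as window averages
          (∀ K t, |t| ≤ (cr F θ hP g₀ os).l₀ → ∀ τ ∈ (cr F θ hP g₀ os).T K, 0 ≤ (cr F θ hP g₀ os).shA K t τ) ∧
          (∀ K t, |t| ≤ (cr F θ hP g₀ os).l₀ → ∀ τ ∈ (cr F θ hP g₀ os).T K, (cr F θ hP g₀ os).shA K t τ ≤ (cr F θ hP g₀ os).A K t τ) ∧
          (∀ K t, |t| ≤ (cr F θ hP g₀ os).l₀ → ∀ τ ∈ (cr F θ hP g₀ os).T K, (cr F θ hP g₀ os).shA K t τ ≤ ∑ s ∈ SA K, pieceA K t s τ) ∧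
          (∀ K t s, Measurable (wA K t s)) ∧ (∀ j, 0 < θA j) ∧ (∀ j, 0 < κA j ∧ κA j < 1) ∧ (∀ j, 0 ≤ ρA j) ∧
          (∀ K t, |t| ≤ (cr F θ hP g₀ os).l₀ → ∀ s ∈ SA K, 0 ≤ MA K t s) ∧
          (∀ K t, |t| ≤ (cr F θ hP g₀ os).l₀ → ∀ s ∈ SA K, ∀ τ ∈ (cr F θ hP g₀ os).T K,
            IntegrableOn (fun s' => pcA K t s s' τ) (Icc ((1 - κA (lvlA K s)) * θA (lvlA K s)) (θA (lvlA K s)))) ∧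
          (∀ K t, |t| ≤ (cr F θ hP g₀ os).l₀ → ∀ s ∈ SA K, ∀ τ ∈ (cr F θ hP g₀ os).T K,
            IntegrableOn (fun s' => AsA K t s s' τ) (Icc ((1 - κA (lvlA K s)) * θA (lvlA K s)) (θA (lvlA K s)))) ∧
          (∀ K t, |t| ≤ (cr F θ hP g₀ os).l₀ → ∀ s ∈ SA K, ∀ s' ∈ Icc ((1 - κA (lvlA K s)) * θA (lvlA K s)) (θA (lvlA K s)),
            ∑ τ ∈ (cr F θ hP g₀ os).T K, pcA K t s s' τ ≤ MA K t s * (νA K t s {x | s' * (1 - ρA (lvlA K s)) ≤ wA K t s x ∧ wA K t s x < s'}).toReal) ∧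
          (∀ K t, |t| ≤ (cr F θ hP g₀ os).l₀ → ∀ s ∈ SA K, ∀ s' ∈ Icc ((1 - κA (lvlA K s)) * θA (lvlA K s)) (θA (lvlA K s)),
            MA K t s * (νA K t s univ).toReal ≤ ∑ τ ∈ (cr F θ hP g₀ os).T K, AsA K t s s' τ) ∧
          (∀ K t, |t| ≤ (cr F θ hP g₀ os).l₀ → ∀ s ∈ SA K, ∀ τ ∈ (cr F θ hP g₀ os).T K, pieceA K t s τ =
            (κA (lvlA K s) * θA (lvlA K s))⁻¹ * ∫ s' in Icc ((1 - κA (lvlA K s)) * θA (lvlA K s)) (θA (lvlA K s)), pcA K t s s' τ) ∧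
          (∀ K t, |t| ≤ (cr F θ hP g₀ os).l₀ → ∀ s ∈ SA K, ∀ τ ∈ (cr F θ hP g₀ os).T K, (cr F θ hP g₀ os).A K t τ =
            (κA (lvlA K s) * θA (lvlA K s))⁻¹ * ∫ s' in Icc ((1 - κA (lvlA K s)) * θA (lvlA K s)) (θA (lvlA K s)), AsA K t s s' τ) ∧
          -- run B: the same
          (∀ K t, |t| ≤ (cr F θ hP g₀ os).l₀ → ∀ τ ∈ (cr F θ hP g₀ os).T K, 0 ≤ (cr F θ hP g₀ os).shB K t τ) ∧
          (∀ K t, |t| ≤ (cr F θ hP g₀ os).l₀ → ∀ τ ∈ (cr F θ hP g₀ os).T K, (cr F θ hP g₀ os).shB K t τ ≤ (cr F θ hP g₀ os).B K t τ) ∧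
          (∀ K t, |t| ≤ (cr F θ hP g₀ os).l₀ → ∀ τ ∈ (cr F θ hP g₀ os).T K, (cr F θ hP g₀ os).shB K t τ ≤ ∑ s ∈ SB K, pieceB K t s τ) ∧
          (∀ K t s, Measurable (wB K t s)) ∧ (∀ j, 0 < θB j) ∧ (∀ j, 0 < κB j ∧ κB j < 1) ∧ (∀ j, 0 ≤ ρB j) ∧
          (∀ K t, |t| ≤ (cr F θ hP g₀ os).l₀ → ∀ s ∈ SB K, 0 ≤ MB K t s) ∧
          (∀ K t, |t| ≤ (cr F θ hP g₀ os).l₀ → ∀ s ∈ SB K, ∀ τ ∈ (cr F θ hP g₀ os).T K,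
            IntegrableOn (fun s' => pcB K t s s' τ) (Icc ((1 - κB (lvlB K s)) * θB (lvlB K s)) (θB (lvlB K s)))) ∧
          (∀ K t, |t| ≤ (cr F θ hP g₀ os).l₀ → ∀ s ∈ SB K, ∀ τ ∈ (cr F θ hP g₀ os).T K,
            IntegrableOn (fun s' => AsB K t s s' τ) (Icc ((1 - κB (lvlB K s)) * θB (lvlB K s)) (θB (lvlB K s)))) ∧
          (∀ K t, |t| ≤ (cr F θ hP g₀ os).l₀ → ∀ s ∈ SB K, ∀ s' ∈ Icc ((1 - κB (lvlB K s)) * θB (lvlB K s)) (θB (lvlB K s)),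
            ∑ τ ∈ (cr F θ hP g₀ os).T K, pcB K t s s' τ ≤ MB K t s * (νB K t s {x | s' * (1 - ρB (lvlB K s)) ≤ wB K t s x ∧ wB K t s x < s'}).toReal) ∧
          (∀ K t, |t| ≤ (cr F θ hP g₀ os).l₀ → ∀ s ∈ SB K, ∀ s' ∈ Icc ((1 - κB (lvlB K s)) * θB (lvlB K s)) (θB (lvlB K s)),
            MB K t s * (νB K t s univ).toReal ≤ ∑ τ ∈ (cr F θ hP g₀ os).T K, AsB K t s s' τ) ∧
          (∀ K t, |t| ≤ (cr F θ hP g₀ os).l₀ → ∀ s ∈ SB K, ∀ τ ∈ (cr F θ hP g₀ os).T K, pieceB K t s τ =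
            (κB (lvlB K s) * θB (lvlB K s))⁻¹ * ∫ s' in Icc ((1 - κB (lvlB K s)) * θB (lvlB K s)) (θB (lvlB K s)), pcB K t s s' τ) ∧
          (∀ K t, |t| ≤ (cr F θ hP g₀ os).l₀ → ∀ s ∈ SB K, ∀ τ ∈ (cr F θ hP g₀ os).T K, (cr F θ hP g₀ os).B K t τ =
            (κB (lvlB K s) * θB (lvlB K s))⁻¹ * ∫ s' in Icc ((1 - κB (lvlB K s)) * θB (lvlB K s)) (θB (lvlB K s)), AsB K t s s' τ) ∧
          -- windows (N20), admissible widths, rate (N16), record weight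
          LiveWindow SA lvlA N₁ νbar ∧ LiveWindow SB lvlB N₁ νbar ∧ 0 < κmin ∧ (∀ j, κmin ≤ κA j) ∧ (∀ j, κmin ≤ κB j) ∧
          0 < ϑ ∧ ϑ < 1 ∧ (∀ j, ρA j ≤ c₁ * ϑ ^ j) ∧ (∀ j, ρB j ≤ c₁ * ϑ ^ j))

include hmix

/-! ## §1 NE7c at the reading's carriers with an explicit geometric weight, from the sharp-push mixture data -/

/-- **THE K5 FACE OF N21 ON THE MIXTURE ROAD — A GEOMETRIC SHELL WEIGHT AT EVERY ADMISSIBLE STAGE-12 TUPLE.**  For a spine reading `cr` whose carriers carry, at every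
admissible tuple with provisos and every `(g₀, os)`, module 12a's sharp-push mixture data for both runs, the live windows and the width rate (`hmix`; NO clause on the
weight slot): `∃ ϑ C, 0 < ϑ < 1 ∧ 0 ≤ C ∧ ShellWeightBound (cr F θ hP g₀ os) … (K ↦ C·ϑ^K)` — `n21_knit_thresholdMixture` at its own geometric majorant
`C = 2((N₁+1)ν̄(2κ_min⁻¹)c₁ϑ^{−N₁})` (`0 ≤ ν̄` from the live window, `0 ≤ c₁` from `0 ≤ ρ_0 ≤ c₁`).  NO (M1) binder.  CONDITIONAL on every displayed binder; NE7c NOT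
proved; N21 NOT discharged. [bookkeeping] -/
theorem shellWeightBound_geometric_keyed₁₂_of_sharpPushMixture (F : T4Family) (θ : Stage12Params F N) (hP : θ.Provisos₁₂ F N) (hθ : θ.Admissible F N)
    (g₀ : ℕ → ℝ) (os : List (ULoop F)) :
    ∃ ϑ C : ℝ, 0 < ϑ ∧ ϑ < 1 ∧ 0 ≤ C ∧ ShellWeightBound (cr F θ hP g₀ os).l₀ (cr F θ hP g₀ os).T (cr F θ hP g₀ os).A (cr F θ hP g₀ os).B
      (cr F θ hP g₀ os).shA (cr F θ hP g₀ os).shB fun K => C * ϑ ^ K := by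
  obtain ⟨σA, σB, XA, XB, mA, mB, νA, νB, fA, fB, wA, wB, SA, SB, pieceA, pieceB, lvlA, lvlB, θA, κA, ρA, θB, κB, ρB, MA, MB,
    pcA, AsA, pcB, AsB, N₁, νbar, κmin, c₁, ϑ, sh_nonnegA, sh_leA, coverA, hwA, hθA, hκA, hρA, hMA, hpcA, hAsA, hpushA, htotalA, hpieceMixA,
    hAMixA, sh_nonnegB, sh_leB, coverB, hwB, hθB, hκB, hρB, hMB, hpcB, hAsB, hpushB, htotalB, hpieceMixB, hAMixB, hwinA, hwinB, hκmin,
    hκminA, hκminB, hϑ0, hϑ1, hrA, hrB⟩ := hmix F θ hP hθ g₀ os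
  have hν : 0 ≤ νbar := hwinA.νbar_nonneg
  have hc₁ : 0 ≤ c₁ := by have h := hrA 0; rw [pow_zero, mul_one] at h; exact (hρA 0).trans h
  refine ⟨ϑ, 2 * ((N₁ + 1) * νbar * (2 * κmin⁻¹) * c₁ * ϑ⁻¹ ^ N₁), hϑ0, hϑ1, by positivity, ?_⟩
  exact n21_knit_thresholdMixture sh_nonnegA sh_leA coverA hwA hθA hκA hρA hMA hpcA hAsA hpushA htotalA hpieceMixA hAMixA sh_nonnegB sh_leB
    coverB hwB hθB hκB hρB hMB hpcB hAsB hpushB htotalB hpieceMixB hAMixB hwinA hwinB hκmin hκminA hκminB hϑ0 hϑ1 hrA hrB (fun K => le_rfl)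
    ((summable_geometric_of_lt_one hϑ0.le hϑ1).mul_left _)

/-! ## §2 The composite at the homes with the N21 slot on the mixture road -/

/-- **N27 = B5 AT THE STAGE-12 RECORD FROM THE HOMES, THE N21 SLOT SUPPLIED BY SHARP PUSHES.**  dag-n27-c XXVII's composite (six K4 stubs at `RRec₁₂ 𝔯`, `S_N27x ₁₂C (SRec₁₂ cr)`,
`S_N20 (SRec₁₂ cr)`, the home-keyed N19′ edge `h19`) with the N21 slot DISCHARGED through module 9's `spine_rec12C_of_homes₁₂_existsShellWeight` by §1: on the mixture road N21
contributes ONLY `hmix` (sharp pushes + (R) + widths + windows + the width rate) — no (M1), no weight slot to match.  Conclusion `Spine ₁₂C`.  Every binder a HYPOTHESIS (0∕1 today);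
N21 ∕ N27 NOT discharged; K3′ NOT claimed. [bookkeeping] -/
theorem spine_rec12C_of_homes₁₂_sharpPushMixture (𝔯 : RateReading₁₂ N) (h14 : S_N14 (RRec₁₂ 𝔯)) (h15 : S_N15 (RRec₁₂ 𝔯)) (h16 : S_N16 (RRec₁₂ 𝔯))
    (h17 : S_N17 (RRec₁₂ 𝔯)) (h18 : S_N18 (RRec₁₂ 𝔯)) (h22 : S_N22 (RRec₁₂ 𝔯)) (hx' : S_N27x (fun F D w => IsRecordOfRecord₁₂C F N D w) (SRec₁₂ cr))
    (h20 : S_N20 (SRec₁₂ cr))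
    (h19 : ∀ (F : T4Family) (θ : Stage12Params F N) (hP : θ.Provisos₁₂ F N), θ.Admissible F N → ∀ (g₀ : ℕ → ℝ) (os : List (ULoop F))
      (h : IsDatumOfRecord₁₂C F N (datumOfRecord₁₂ F N θ hP)) (k : ℕ),
      RatesAt (datumOfRecord₁₂ F N θ hP) (rateCarriersOfRecord₁₂ 𝔯 F h.params h.provisos g₀ os k) → letI := (cr F θ hP g₀ os).dec
        ∃ δ : ℕ → ℝ, NE7.Core (cr F θ hP g₀ os).l₀ (cr F θ hP g₀ os).vol (cr F θ hP g₀ os).T (cr F θ hP g₀ os).Bad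
          (fun K t τ => (cr F θ hP g₀ os).A K t τ - (cr F θ hP g₀ os).shA K t τ) (fun K t τ => (cr F θ hP g₀ os).B K t τ - (cr F θ hP g₀ os).shB K t τ) δ ∧
          Summable δ) :
    Spine (N := N) fun F D w => IsRecordOfRecord₁₂C F N D w :=
  spine_rec12C_of_homes₁₂_existsShellWeight cr 𝔯 h14 h15 h16 h17 h18 h22 hx' h20
    (fun F θ hP hθ g₀ os => by
      obtain ⟨ϑ, C, -, -, -, hSW⟩ := shellWeightBound_geometric_keyed₁₂_of_sharpPushMixture cr hmix F θ hP hθ g₀ os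
      exact ⟨_, hSW⟩) h19

end Summit.QuantumFields.YangMills.Theorems.N21AtSRec12Mixture

end
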